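import Mathlib
import HarnessLib
import Literature.MathematicalPhysics.QuantumLattice.GaugeGroups
import Literature.MathematicalPhysics.QuantumFieldTheory.ConstructiveQFTWave0
import Literature.MathematicalPhysics.QuantumFieldTheory.LatticeGaugeProofs
import Literature.MathematicalPhysics.QuantumFieldTheory.U1GinibreComparison
import Literature.MathematicalPhysics.QuantumLattice.AbelianFieldTensor
import Literature.MathematicalPhysics.QuantumLattice.AbelianMagneticFlux
import Summits.Ventures.LatticeQCDFlow.Exactness.SymmetricMetropolis
import Summits.Ventures.LatticeQCDFlow.Scaling.LatticePeeling
import Summits.Ventures.LatticeQCDFlow.Scaling.LatticeEntropyU1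
import Summits.Ventures.LatticeQCDFlow.Scaling.CircleBallVolume
import Summits.Ventures.LatticeQCDFlow.Scaling.FluxPatch
import Summits.Ventures.LatticeQCDFlow.Scaling.FluxSectorCollar
import Summits.Ventures.LatticeQCDFlow.Scaling.SliceTwistWitness
import Summits.Ventures.LatticeQCDFlow.Scaling.FluxTunnellingU1Explicit
import Summits.Ventures.LatticeQCDFlow.Scaling.RowFields
import Summits.Ventures.LatticeQCDFlow.Scaling.BalancedSliceTwist
import Summits.Ventures.LatticeQCDFlow.Scaling.FluxTunnellingU1MaxPlaquette
import Summits.Ventures.LatticeQCDFlow.Scaling.FluxInsertionKernel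

/-!
# The wrapping-line flux insertion under the 2-d `U(1)` Wilson measure: a two-sided bracket

HONEST FRAMING: exact (Metropolis-corrected) sampling algorithms for lattice gauge theory;
figures of merit are autocorrelation/cost numbers at stated couplings and volumes; no
continuum-physics claim.

Venture `LatticeQCDFlow` (cell pub-lqcd), topic `Scaling`, FANOUT row 29 (theory2, gen-19), item 99.
NEW WORK over Mathlib, row 9's `Exactness/SymmetricMetropolis` and items 92/93/97/98; nothing here is
cited as a fact.  Printed counterpart, named only: the winding-insertion move of [AlbandeaEtAl2021, §3].

`W = sliceTwist L` (lean-1: the direction-`0` links of the wrapping line `x₀ = 0` carry `e^{2πi x₁/L}`;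
its `L` plaquettes have angle `−2π/L`, flux charge `−1`).  The kernel `lineInsertionMH β` =
`insertionMH (sliceTwist L) e^{−βS}` (item 98) proposes `U ↦ W^{±1} U` and Metropolis-filters.

* `S(W) = L(1 − cos(2π/L))` (`wilsonAction_sliceTwist`, item 98 §5).
* §1 EXACT and LOCAL: `lineInsertionMH_invariant` (the Wilson measure `μ_{β,L}` is invariant) and
  `ae_lineInsertionMH_eq_off` (it moves only `sliceLinks L`), so items 92/97 and lean-1's action law
  bound its tunnelling probability from ABOVE.
* §2 FROM BELOW: both insertions change the charge as soon as every line plaquette angle lies in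
  `(2π/L − π, π − 2π/L]` (`bothChange_of_branch`, item 92's `topCharge_mul`); the complement forces a
  line plaquette `2cos(π/L)`-far from `1`, of Wilson probability `≤ L e^{−β(1 + cos(2π/L))}/z₁(β)²`
  (item 97).  Hence (`u1_lineInsertion_floor`, `3 ≤ L`, `L` even, `β ≥ 0`)
  `z₁(β)² (μ_{β,L} ⊗ K){Q ≠ Q'} ≥ ½ e^{−βL(1 − cos(2π/L))} (z₁(β)² − L e^{−β(1 + cos(2π/L))})`,
  and with item 97's ceiling the BRACKET `u1_lineInsertion_bracket`:
  `½ e^{−βL(1−cos(2π/L))}(z₁² − L e^{−β(1+cos(2π/L))}) ≤ z₁² P{Q ≠ Q'} ≤ 2L e^{−β(1−cos(π/L))}`.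
  Exponents: floor `βL(1 − cos(2π/L)) → 2π²β/L`, ceiling (lean-1's action currency, the sharper one)
  `βL(1 − cos(π/L)) → π²β/(2L)`: the necessity exponent is attained within the factor
  `(1 − cos(2π/L))/(1 − cos(π/L)) = 4cos²(π/(2L)) < 4` by this explicit exact move.

HONEST SCOPE: `U(1)`, d = 2, even `L ≥ 4`; the floor is a per-step tunnelling probability of ONE
explicit kernel, not a mixing-time statement; whether the factor `< 4` closes (the heuristic Gaussian
computation says the same move attains the exponent `π²β/(2L)`, helped by the fluctuations of the line
flux) is NOT proved here.
-/

noncomputable section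

namespace Summit.Ventures.LatticeQCDFlow.Theory2.Lattice.Flux

open MeasureTheory ProbabilityTheory Real
open scoped ENNReal
open Literature.MathematicalPhysics.QuantumFieldTheory Literature.MathematicalPhysics.QuantumLattice
open Summit.Ventures.LatticeQCDFlow.Exactness

variable {L : ℕ} [NeZero L]

/-! ## §1 The line-insertion kernel: exact and local -/

/-- **The line-insertion Metropolis kernel** under the Wilson weight `e^{−βS}`. [folklore] -/
def lineInsertionMH (β : ℝ) : Kernel (GaugeConfig 2 L Circle) (GaugeConfig 2 L Circle) :=
  insertionMH (sliceTwist L) (u1Weight (d := 2) (L := L) β)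

/-- It is a Markov kernel. [folklore] -/
instance instIsMarkovKernelLineInsertionMH (β : ℝ) : IsMarkovKernel (lineInsertionMH (L := L) β) := by
  haveI : Fact (Measurable (u1Weight (d := 2) (L := L) β)) := ⟨measurable_u1Weight β⟩
  unfold lineInsertionMH; infer_instance

/-- **Exactness**: the Wilson measure is invariant. [folklore] -/
theorem lineInsertionMH_invariant (β : ℝ) :
    Kernel.Invariant (lineInsertionMH (L := L) β) (wilsonMeasure (d := 2) (L := L) u1Rep β) := by
  have h : Kernel.Invariant (lineInsertionMH (L := L) β) (wilsonWeight (d := 2) (L := L) u1Rep β) :=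
    insertionMH_invariant (sliceTwist L) (measurable_u1Weight β) (u1Weight_pos β)
  unfold Kernel.Invariant at h ⊢
  rw [wilsonMeasure, Measure.bind_smul, h]

/-- The set of pairs agreeing off `Λ` is measurable. [folklore] -/
theorem measurableSet_eq_off (Λ : Set (Edge 2 L)) :
    MeasurableSet {q : GaugeConfig 2 L Circle × GaugeConfig 2 L Circle | ∀ e ∉ Λ, q.1 e = q.2 e} := by
  have h : {q : GaugeConfig 2 L Circle × GaugeConfig 2 L Circle | ∀ e ∉ Λ, q.1 e = q.2 e} =
      ⋂ e : Edge 2 L, {q | e ∉ Λ → q.1 e = q.2 e} := by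
    ext q; simp only [Set.mem_setOf_eq, Set.mem_iInter]
  rw [h]
  refine MeasurableSet.iInter fun e => ?_
  by_cases he : e ∈ Λ
  · simp [he]
  · simp only [he, not_false_eq_true, forall_const]
    exact measurableSet_eq_fun ((measurable_pi_apply e).comp measurable_fst)
      ((measurable_pi_apply e).comp measurable_snd)

/-- **Locality**: the kernel moves only the links of the wrapping line, under any initial law.
[folklore] -/
theorem ae_lineInsertionMH_eq_off (β : ℝ) (μ : Measure (GaugeConfig 2 L Circle)) [SFinite μ] :
    ∀ᵐ q ∂(μ ⊗ₘ lineInsertionMH (L := L) β), ∀ e ∉ sliceLinks L, q.1 e = q.2 e := by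
  refine Measure.ae_compProd_of_ae_ae (measurableSet_eq_off (sliceLinks L))
    (ae_of_all _ fun U => ?_)
  have hB : MeasurableSet {V : GaugeConfig 2 L Circle | ¬∀ e ∉ sliceLinks L, U e = V e} :=
    ((measurableSet_eq_off (L := L) (sliceLinks L)).preimage measurable_prodMk_left).compl
  have h0 : lineInsertionMH (L := L) β U {V | ¬∀ e ∉ sliceLinks L, U e = V e} = 0 := by
    refine insertionMH_eq_zero (sliceTwist L) (measurable_u1Weight β) U hB ?_ ?_ ?_
    · simp
    · simp only [Set.mem_setOf_eq, not_not, Pi.mul_apply]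
      intro e he
      rw [sliceTwist_apply_of_not_mem he, one_mul]
    · simp only [Set.mem_setOf_eq, not_not, Pi.mul_apply, Pi.inv_apply]
      intro e he
      rw [sliceTwist_apply_of_not_mem he, inv_one, one_mul]
  rw [ae_iff]
  exact h0

/-! ## §2 The floor and the bracket -/

/-- The branch event: every plaquette angle of the line lies in `(2π/L − π, π − 2π/L]`, so that
adding `∓2π/L` keeps it in the principal branch. [folklore] -/
def lineBranch (L : ℕ) [NeZero L] : Set (GaugeConfig 2 L Circle) :=
  {U | ∀ x : Site 2 L, x 0 = 0 →
    2 * π / L - π < abelianFieldTensor U x 0 1 ∧ abelianFieldTensor U x 0 1 ≤ π - 2 * π / L}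

/-- The field tensor of the inverse slice twist: `+2π/L` on the line, `0` elsewhere. [folklore] -/
theorem abelianFieldTensor_sliceTwist_inv (hL : 3 ≤ L) (y : Site 2 L) :
    abelianFieldTensor (sliceTwist L)⁻¹ y 0 1 = if y 0 = 0 then 2 * π / L else 0 := by
  have hLpos : (0 : ℝ) < L := by exact_mod_cast (show 0 < L by omega)
  have hL3 : (3 : ℝ) ≤ L := by exact_mod_cast hL
  have hhol : plaquetteHolonomy (sliceTwist L)⁻¹ y 0 1 =
      if y 0 = 0 then ZMod.toCircle (1 : ZMod L) else 1 := by
    rw [plaquetteHolonomy_inv, plaquetteHolonomy_sliceTwist]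
    split_ifs <;> simp
  split_ifs with hy
  · refine abelianFieldTensor_eq_of_plaquette_eq_exp (θ := 2 * π / L) ?_ ?_ ?_
    · rw [hhol, if_pos hy, toCircle_one_eq_exp]
    · have : 0 < 2 * π / (L : ℝ) := by positivity
      linarith [Real.pi_pos]
    · rw [div_le_iff₀ hLpos]; nlinarith [Real.pi_pos]
  · refine abelianFieldTensor_eq_of_plaquette_eq_exp (θ := 0) ?_ (by linarith [Real.pi_pos])
      Real.pi_pos.le
    rw [hhol, if_neg hy, Circle.exp_zero]

/-- The inverse slice twist has flux charge `+1`. [folklore] -/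
theorem topCharge_sliceTwist_inv (hL : 3 ≤ L) :
    topCharge (0 : Site 2 L) 0 1 (sliceTwist L)⁻¹ = 1 := by
  have h := topCharge_mul (0 : Site 2 L) 0 1 (U := sliceTwist L) (V := (sliceTwist L)⁻¹) (fun x => by
    rw [abelianFieldTensor_sliceTwist hL, abelianFieldTensor_sliceTwist_inv hL]
    split_ifs <;> constructor <;> linarith [Real.pi_pos])
  rw [mul_inv_cancel, topCharge_one', topCharge_sliceTwist hL] at h
  linarith

/-- **On the branch event both insertions change the charge** (by `∓1`; item 92's additivity).
[folklore] -/
theorem bothChange_of_branch (hL : 3 ≤ L) {U : GaugeConfig 2 L Circle} (hU : U ∈ lineBranch L) :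
    U ∈ bothChange (sliceTwist L) (0 : Site 2 L) 0 1 := by
  have hLpos : (0 : ℝ) < L := by exact_mod_cast (show 0 < L by omega)
  have h2π : 0 < 2 * π / (L : ℝ) := by positivity
  constructor
  · have h := topCharge_mul (0 : Site 2 L) 0 1 (U := sliceTwist L) (V := U) (fun x => by
      rw [abelianFieldTensor_sliceTwist hL]
      by_cases hx : x 0 = 0
      · rw [if_pos hx]
        obtain ⟨h1, _⟩ := hU x hx
        exact ⟨by linarith, by linarith [abelianFieldTensor_le_pi U x 0 1]⟩
      · rw [if_neg hx, zero_add]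
        exact ⟨neg_pi_lt_abelianFieldTensor U x 0 1, abelianFieldTensor_le_pi U x 0 1⟩)
    show topCharge (0 : Site 2 L) 0 1 (sliceTwist L * U) ≠ topCharge (0 : Site 2 L) 0 1 U
    rw [h, topCharge_sliceTwist hL]
    intro h'; linarith
  · have h := topCharge_mul (0 : Site 2 L) 0 1 (U := (sliceTwist L)⁻¹) (V := U) (fun x => by
      rw [abelianFieldTensor_sliceTwist_inv hL]
      by_cases hx : x 0 = 0
      · rw [if_pos hx]
        obtain ⟨_, h2⟩ := hU x hx
        exact ⟨by linarith [neg_pi_lt_abelianFieldTensor U x 0 1], by linarith⟩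
      · rw [if_neg hx, zero_add]
        exact ⟨neg_pi_lt_abelianFieldTensor U x 0 1, abelianFieldTensor_le_pi U x 0 1⟩)
    show topCharge (0 : Site 2 L) 0 1 ((sliceTwist L)⁻¹ * U) ≠ topCharge (0 : Site 2 L) 0 1 U
    rw [h, topCharge_sliceTwist_inv hL]
    intro h'; linarith

omit [NeZero L] in
/-- **A plaquette angle of size at least `π − α` (`0 ≤ α ≤ π`) is a plaquette `2cos(α/2)`-far
from `1`.** [folklore] -/
theorem two_cos_le_dist_of_pi_sub_le_abs {U : GaugeConfig 2 L Circle} {x : Site 2 L} {α : ℝ}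
    (hα0 : 0 ≤ α) (hαπ : α ≤ π) (h : π - α ≤ |abelianFieldTensor U x 0 1|) :
    2 * Real.cos (α / 2) ≤ dist (plaquetteHolonomy U x 0 1) 1 := by
  set F := abelianFieldTensor U x 0 1 with hFdef
  have hre : ((plaquetteHolonomy U x 0 1 : Circle) : ℂ).re = Real.cos F := by
    have h := Complex.cos_arg (Circle.coe_ne_zero (plaquetteHolonomy U x 0 1))
    rw [Circle.norm_coe, div_one] at h
    exact h.symm
  have hcos : Real.cos F ≤ Real.cos (π - α) := by
    rw [← Real.cos_abs F]
    exact Real.cos_le_cos_of_nonneg_of_le_pi (by linarith) (abs_abelianFieldTensor_le_pi U x 0 1) h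
  have hd := one_sub_re_eq_dist_sq (plaquetteHolonomy U x 0 1)
  have hc2 : Real.cos (π - α) = -Real.cos α := Real.cos_pi_sub _
  have hdouble : Real.cos α = 2 * Real.cos (α / 2) ^ 2 - 1 := by
    have h := Real.cos_two_mul (α / 2)
    rwa [show 2 * (α / 2) = α by ring] at h
  have hsq : (2 * Real.cos (α / 2)) ^ 2 ≤ dist (plaquetteHolonomy U x 0 1) 1 ^ 2 := by
    nlinarith [hd, hre, hcos]
  have hcos0 : 0 ≤ Real.cos (α / 2) :=
    Real.cos_nonneg_of_neg_pi_div_two_le_of_le (by linarith [Real.pi_pos]) (by linarith)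
  exact (pow_le_pow_iff_left₀ (by positivity) dist_nonneg two_ne_zero).mp hsq

/-- **Off the branch event some line plaquette is `2cos(π/L)`-far from `1`.** [folklore] -/
theorem exists_far_of_not_branch (hL : 2 ≤ L) {U : GaugeConfig 2 L Circle} (hU : U ∉ lineBranch L) :
    ∃ p ∈ linePositions L,
      2 * Real.cos (π / L) ≤ dist (plaquetteHolonomy U (planeSite (0 : Site 2 L) 0 1 p) 0 1) 1 := by
  have hLpos : (0 : ℝ) < L := by exact_mod_cast (show 0 < L by omega)
  have hL2 : (2 : ℝ) ≤ L := by exact_mod_cast hL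
  simp only [lineBranch, Set.mem_setOf_eq, not_forall, not_and_or, not_lt, not_le, exists_prop] at hU
  obtain ⟨x, hx0, hx⟩ := hU
  refine ⟨(x 0, x 1), mem_linePositions.mpr hx0, ?_⟩
  have hxs : planeSite (0 : Site 2 L) 0 1 (x 0, x 1) = x := by
    ext i; fin_cases i <;> simp [planeSite]
  rw [hxs, show π / (L : ℝ) = 2 * π / L / 2 by ring]
  refine two_cos_le_dist_of_pi_sub_le_abs (by positivity)
    (by rw [div_le_iff₀ hLpos]; nlinarith [Real.pi_pos]) ?_
  rcases hx with h | h
  · exact le_trans (by linarith) (neg_le_abs (abelianFieldTensor U x 0 1))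
  · exact h.le.trans (le_abs_self _)

/-- `(2cos(π/L))²/2 = 1 + cos(2π/L)`. [folklore] -/
theorem two_cos_sq_div_two (L : ℕ) :
    (2 * Real.cos (π / L)) ^ 2 / 2 = 1 + Real.cos (2 * π / L) := by
  rw [show 2 * π / (L : ℝ) = 2 * (π / L) by ring, Real.cos_two_mul]; ring

/-- **The Wilson probability of leaving the branch event**:
`z₁(β)² μ_{β,L}(lineBranchᶜ) ≤ L e^{−β(1 + cos(2π/L))}`. [folklore] -/
theorem u1_z1_sq_mul_measure_lineBranch_compl_le (hL : 2 ≤ L) (hLe : Even L) {β : ℝ} (hβ : 0 ≤ β) :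
    z1 u1Rep β ^ 2 * wilsonMeasure (d := 2) (L := L) u1Rep β (lineBranch L)ᶜ ≤
      L * ENNReal.ofReal (Real.exp (-(β * (1 + Real.cos (2 * π / L))))) := by
  have hLpos : (0 : ℝ) < L := by exact_mod_cast (show 0 < L by omega)
  have hL2 : (2 : ℝ) ≤ L := by exact_mod_cast hL
  have hcos0 : 0 ≤ Real.cos (π / L) := Real.cos_nonneg_of_neg_pi_div_two_le_of_le
    (by linarith [Real.pi_pos, show 0 < π / (L : ℝ) by positivity])
    (div_le_div_of_nonneg_left Real.pi_pos.le two_pos hL2)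
  have hc0 : 0 ≤ 2 * Real.cos (π / L) := by positivity
  calc z1 u1Rep β ^ 2 * wilsonMeasure (d := 2) (L := L) u1Rep β (lineBranch L)ᶜ
      ≤ z1 u1Rep β ^ 2 * wilsonMeasure (d := 2) (L := L) u1Rep β
          {U | ∃ p ∈ linePositions L,
            2 * Real.cos (π / L) ≤ dist (plaquetteHolonomy U (planeSite (0 : Site 2 L) 0 1 p) 0 1) 1} :=
        mul_le_mul_right (measure_mono fun U hU => exists_far_of_not_branch hL hU) _
    _ ≤ (linePositions L).card * ENNReal.ofReal (Real.exp (-(β * ((2 * Real.cos (π / L)) ^ 2 / 2)))) :=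
        u1_z1_sq_mul_measure_exists_dist_ge_le hL hLe hβ 0 (linePositions L) hc0
    _ = L * ENNReal.ofReal (Real.exp (-(β * (1 + Real.cos (2 * π / L))))) := by
        rw [card_linePositions, two_cos_sq_div_two]

/-- **FLOOR.**  For the line-insertion Metropolis kernel under the 2-d `U(1)` Wilson measure
(`3 ≤ L`, `L` even, `β ≥ 0`):
`z₁(β)² (μ_{β,L} ⊗ K){Q ≠ Q'} ≥ ½ e^{−βL(1 − cos(2π/L))} (z₁(β)² − L e^{−β(1 + cos(2π/L))})`. [folklore] -/
theorem u1_lineInsertion_floor (hL : 3 ≤ L) (hLe : Even L) {β : ℝ} (hβ : 0 ≤ β) :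
    2⁻¹ * ENNReal.ofReal (Real.exp (-(β * (L * (1 - Real.cos (2 * π / L)))))) *
        (z1 u1Rep β ^ 2 - L * ENNReal.ofReal (Real.exp (-(β * (1 + Real.cos (2 * π / L)))))) ≤
      z1 u1Rep β ^ 2 * ((wilsonMeasure (d := 2) (L := L) u1Rep β) ⊗ₘ lineInsertionMH (L := L) β)
        {q | topCharge (0 : Site 2 L) 0 1 q.1 ≠ topCharge (0 : Site 2 L) 0 1 q.2} := by
  have hL2 : 2 ≤ L := by omega
  set μW := wilsonMeasure (d := 2) (L := L) u1Rep β with hμW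
  haveI : IsProbabilityMeasure μW := isProbabilityMeasure_wilsonMeasure u1Rep continuous_u1Rep β
  set Z := z1 u1Rep β ^ 2 with hZ
  set B := (L : ℝ≥0∞) * ENNReal.ofReal (Real.exp (-(β * (1 + Real.cos (2 * π / L))))) with hB
  set E := ENNReal.ofReal (Real.exp (-(β * (L * (1 - Real.cos (2 * π / L)))))) with hE
  have hfloor := compProd_insertionMH_topCharge_ne_ge hβ (sliceTwist L) (0 : Site 2 L) 0 1 μW
  rw [wilsonAction_sliceTwist] at hfloor
  have hmono : μW (lineBranch L) ≤ μW (bothChange (sliceTwist L) (0 : Site 2 L) 0 1) :=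
    measure_mono fun U hU => bothChange_of_branch hL hU
  have hcompl : Z * μW (lineBranch L)ᶜ ≤ B := u1_z1_sq_mul_measure_lineBranch_compl_le hL2 hLe hβ
  have hsplit : Z ≤ Z * μW (lineBranch L) + B := by
    calc Z = Z * μW Set.univ := by rw [measure_univ, mul_one]
      _ ≤ Z * (μW (lineBranch L) + μW (lineBranch L)ᶜ) := by
          refine mul_le_mul_right ?_ _
          rw [← Set.union_compl_self (lineBranch L)]
          exact measure_union_le _ _
      _ = Z * μW (lineBranch L) + Z * μW (lineBranch L)ᶜ := mul_add _ _ _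
      _ ≤ Z * μW (lineBranch L) + B := add_le_add le_rfl hcompl
  have htsub : Z - B ≤ Z * μW (lineBranch L) := tsub_le_iff_right.mpr hsplit
  calc 2⁻¹ * E * (Z - B) ≤ 2⁻¹ * E * (Z * μW (lineBranch L)) := mul_le_mul_right htsub _
    _ ≤ 2⁻¹ * E * (Z * μW (bothChange (sliceTwist L) (0 : Site 2 L) 0 1)) :=
        mul_le_mul_right (mul_le_mul_right hmono _) _
    _ = Z * (2⁻¹ * E * μW (bothChange (sliceTwist L) (0 : Site 2 L) 0 1)) := by ring
    _ ≤ Z * (μW ⊗ₘ lineInsertionMH (L := L) β)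
          {q | topCharge (0 : Site 2 L) 0 1 q.1 ≠ topCharge (0 : Site 2 L) 0 1 q.2} :=
        mul_le_mul_right hfloor _

/-- **BRACKET.**  Floor (this file) and ceiling (item 97's max-plaquette law applied to this exact,
line-local kernel) for ONE explicit sampler:
`½ e^{−βL(1−cos(2π/L))}(z₁² − L e^{−β(1+cos(2π/L))}) ≤ z₁² P{Q ≠ Q'} ≤ 2L e^{−β(1−cos(π/L))}`.
[folklore] -/
theorem u1_lineInsertion_bracket (hL : 3 ≤ L) (hLe : Even L) {β : ℝ} (hβ : 0 ≤ β) :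
    2⁻¹ * ENNReal.ofReal (Real.exp (-(β * (L * (1 - Real.cos (2 * π / L)))))) *
        (z1 u1Rep β ^ 2 - L * ENNReal.ofReal (Real.exp (-(β * (1 + Real.cos (2 * π / L)))))) ≤
      z1 u1Rep β ^ 2 * ((wilsonMeasure (d := 2) (L := L) u1Rep β) ⊗ₘ lineInsertionMH (L := L) β)
        {q | topCharge (0 : Site 2 L) 0 1 q.1 ≠ topCharge (0 : Site 2 L) 0 1 q.2} ∧
    z1 u1Rep β ^ 2 * ((wilsonMeasure (d := 2) (L := L) u1Rep β) ⊗ₘ lineInsertionMH (L := L) β)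
        {q | topCharge (0 : Site 2 L) 0 1 q.1 ≠ topCharge (0 : Site 2 L) 0 1 q.2} ≤
      2 * L * ENNReal.ofReal (Real.exp (-(β * (1 - Real.cos (π / L))))) := by
  haveI : IsProbabilityMeasure (wilsonMeasure (d := 2) (L := L) u1Rep β) :=
    isProbabilityMeasure_wilsonMeasure u1Rep continuous_u1Rep β
  exact ⟨u1_lineInsertion_floor hL hLe hβ,
    u1_tunnelling_sliceLinks (by omega) hLe hβ (lineInsertionMH (L := L) β) (lineInsertionMH_invariant β)
      (ae_lineInsertionMH_eq_off β _)⟩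

/-- **From the `ENNReal` floor to real numbers** (`β ≥ 1`, lean-1's `z₁(β)² ≥ e^{−1}/(π²β)`):
`½ e₁ (z₁² − b) ≤ z₁² ν(S)` gives `ν(S) ≥ ½ e₁ (1 − b·e·π²·β)`. [folklore] -/
theorem real_floor_of_ennreal_floor {X : Type*} [MeasurableSpace X] {ν : Measure X} [IsFiniteMeasure ν]
    {S : Set X} {β e₁ b : ℝ} (hβ : 1 ≤ β) (he : 0 ≤ e₁) (hb : 0 ≤ b)
    (H : 2⁻¹ * ENNReal.ofReal e₁ * (z1 u1Rep β ^ 2 - ENNReal.ofReal b) ≤ z1 u1Rep β ^ 2 * ν S) :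
    2⁻¹ * e₁ * (1 - b * (Real.exp 1 * π ^ 2 * β)) ≤ ν.real S := by
  have hβ0 : 0 ≤ β := by linarith
  have hβp : 0 < β := by linarith
  have hzt := z1_u1_ne_top hβ0
  set z : ℝ := (z1 u1Rep β).toReal with hz
  have hlow := exp_neg_one_div_le_z1_toReal_sq hβ
  have ha2 : 0 < Real.exp (-1) / (π ^ 2 * β) := by positivity
  have hz2 : 0 < z ^ 2 := lt_of_lt_of_le ha2 hlow
  have hinv' : (z ^ 2)⁻¹ ≤ Real.exp 1 * π ^ 2 * β := by
    calc (z ^ 2)⁻¹ ≤ (Real.exp (-1) / (π ^ 2 * β))⁻¹ := by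
          rw [inv_le_inv₀ hz2 ha2]; exact hlow
      _ = Real.exp 1 * π ^ 2 * β := by rw [inv_div, Real.exp_neg, div_inv_eq_mul]; ring
  have hP0 : 0 ≤ ν.real S := measureReal_nonneg
  have hZ : (z1 u1Rep β ^ 2).toReal = z ^ 2 := by rw [ENNReal.toReal_pow]
  have hbb : b * (z ^ 2)⁻¹ ≤ b * (Real.exp 1 * π ^ 2 * β) := mul_le_mul_of_nonneg_left hinv' hb
  by_cases hbz : z ^ 2 ≤ b
  · -- the claimed floor is non-positive
    have h1 : 1 - b * (Real.exp 1 * π ^ 2 * β) ≤ 0 := by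
      have : 1 ≤ b * (z ^ 2)⁻¹ := by rw [le_mul_inv_iff₀ hz2, one_mul]; exact hbz
      linarith
    exact le_trans (mul_nonpos_of_nonneg_of_nonpos (by positivity) h1) hP0
  · push Not at hbz
    have hBZ : ENNReal.ofReal b ≤ z1 u1Rep β ^ 2 := by
      rw [← ENNReal.toReal_le_toReal ENNReal.ofReal_ne_top (ENNReal.pow_ne_top hzt),
        ENNReal.toReal_ofReal hb, hZ]
      exact hbz.le
    have hne : z1 u1Rep β ^ 2 * ν S ≠ ⊤ := ENNReal.mul_ne_top (ENNReal.pow_ne_top hzt) (measure_ne_top _ _)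
    have key : 2⁻¹ * e₁ * (z ^ 2 - b) ≤ z ^ 2 * ν.real S := by
      have h1 := (ENNReal.toReal_le_toReal (by
        refine ENNReal.mul_ne_top (ENNReal.mul_ne_top (by norm_num) ENNReal.ofReal_ne_top) ?_
        exact ne_top_of_le_ne_top (ENNReal.pow_ne_top hzt) tsub_le_self) hne).mpr H
      rw [ENNReal.toReal_mul, ENNReal.toReal_mul, ENNReal.toReal_sub_of_le hBZ (ENNReal.pow_ne_top hzt),
        hZ, ENNReal.toReal_ofReal hb, ENNReal.toReal_ofReal he, ENNReal.toReal_inv,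
        ENNReal.toReal_mul, hZ] at h1
      simpa [measureReal_def] using h1
    have hfrac : 1 - b * (Real.exp 1 * π ^ 2 * β) ≤ (z ^ 2 - b) / z ^ 2 := by
      rw [sub_div, div_self hz2.ne', div_eq_mul_inv b (z ^ 2)]
      linarith
    calc 2⁻¹ * e₁ * (1 - b * (Real.exp 1 * π ^ 2 * β))
        ≤ 2⁻¹ * e₁ * ((z ^ 2 - b) / z ^ 2) := mul_le_mul_of_nonneg_left hfrac (by positivity)
      _ = 2⁻¹ * e₁ * (z ^ 2 - b) / z ^ 2 := by ring
      _ ≤ z ^ 2 * ν.real S / z ^ 2 := div_le_div_of_nonneg_right key hz2.le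
      _ = ν.real S := by rw [mul_comm, mul_div_assoc, div_self hz2.ne', mul_one]

/-- **The floor in real numbers** (`β ≥ 1`):
`P{Q ≠ Q'} ≥ ½ e^{−βL(1 − cos(2π/L))} (1 − L·e·π²·β·e^{−β(1 + cos(2π/L))})`. [folklore] -/
theorem u1_lineInsertion_floor_real (hL : 3 ≤ L) (hLe : Even L) {β : ℝ} (hβ : 1 ≤ β) :
    2⁻¹ * Real.exp (-(β * (L * (1 - Real.cos (2 * π / L))))) *
        (1 - L * Real.exp (-(β * (1 + Real.cos (2 * π / L)))) * (Real.exp 1 * π ^ 2 * β)) ≤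
      ((wilsonMeasure (d := 2) (L := L) u1Rep β) ⊗ₘ lineInsertionMH (L := L) β).real
        {q | topCharge (0 : Site 2 L) 0 1 q.1 ≠ topCharge (0 : Site 2 L) 0 1 q.2} := by
  haveI : IsProbabilityMeasure (wilsonMeasure (d := 2) (L := L) u1Rep β) :=
    isProbabilityMeasure_wilsonMeasure u1Rep continuous_u1Rep β
  have H := u1_lineInsertion_floor hL hLe (by linarith : (0 : ℝ) ≤ β)
  rw [← ENNReal.ofReal_natCast, ← ENNReal.ofReal_mul (Nat.cast_nonneg _)] at H
  exact real_floor_of_ennreal_floor hβ (Real.exp_pos _).le (by positivity) H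

end Summit.Ventures.LatticeQCDFlow.Theory2.Lattice.Flux

end
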